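import Literature.Barriers.CriticalPhenomena.RigorousRGSmallParameterExpStability
import HarnessLib

/-!
# `RigorousRGSmallParameter` (Slade, Theorem 1.4.1): [BS-rg-IE] Lemma 5.0.8 and the
# Proposition 2.1.1 (Iupper)-type bound `‖e^{-V(X)}F‖_{T_φ} ≤ e^{c|X| - κΣτ}‖F‖_{T_0}(1+‖φ‖_Φ)^A`

Companion ("proof architecture") file of
`Literature/Barriers/CriticalPhenomena/RigorousRGSmallParameter.lean` (estimates layer behind
Theorem 6.3.1 / `Slade2017_prop822`). [BS-rg-IE] §5: "We prove Proposition (prop:Iupper) by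
combining Proposition (prop:Iupperzz) with the following elementary lemma. Lemma 5.0.8. For
`x, u > 0` and any integer `r ≥ max{1,u}`, `(1+x)^{2r} ≤ (2r/u)^r e^{ux²}`,
`1 + u^r(1+x)^{2r} ≤ e^{2ru(1+x²)}`. … Proof of Proposition (prop:Iupper). … By the product property
and [BS-rg-norm, Proposition 3.6.1], `‖I(B)F‖_{T_φ} ≤ ‖𝓘(B)‖_{T_φ}‖1+W(B)‖_{T_φ}‖F‖_{T_φ} ≤ …`".
All statements PROVED (real field, Slade's `V = gτ² + ντ + u` with `g ≥ 0`, `W`-factor not included):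

* `Stability.one_add_sq_le`, **`Stability.one_add_pow_two_mul_le`** ((5.15)),
  `Stability.one_add_pow_le_pow`, **`Stability.one_add_pow_mul_le_exp`** ((5.16));
* `LocalPoly.contDiff_localPolySum`, **`LocalPoly.TphiNorm_le_zero_mul_fieldNorm_pow`**
  (Proposition 3.6.1 in field-norm form: `‖F‖_{T_φ} ≤ ‖F‖_{T_0}(1+‖φ‖_Φ)^A` for `deg F ≤ A ≤ p_𝒩`);
* **`LocalPoly.TphiNorm_exp_neg_localPolySum_mul_le`**: `‖e^{-V(X)}F‖_{T_φ(𝔥)} ≤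
  exp(|X|[gK(q)(n/2)²𝔥⁴ + 2|ν|n𝔥² + 2|u|] + (4|ν| - qg(n/2)𝔥²)Σ_{x∈X}τ_x(φ)) · ‖F‖_{T_0}(1+‖φ‖_Φ)^A`.

Sources: D. C. Brydges, G. Slade, *A renormalisation group method. IV. Stability analysis*, J.
Stat. Phys. 159 (2015) 530–588, arXiv:1403.7255, Proposition 2.1.1, Lemma 5.0.8 and §5
(TeX-source numbering); Brydges–Slade I, arXiv:1403.7244, Proposition 3.6.1.

## References

* [BrydgesSlade2015] D. C. Brydges, G. Slade, *A renormalisation group method. IV*, J. Stat.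
  Phys. **159** (2015) 530–588, arXiv:1403.7255.
* [BrydgesSlade2015RGI] D. C. Brydges, G. Slade, *A renormalisation group method. I*, J. Stat.
  Phys. **159** (2015) 421–460, arXiv:1403.7244.
-/

noncomputable section

namespace Literature.Barriers.CriticalPhenomena

namespace LongRangePhi4

namespace Stability

/-- `1 + x² ≤ (r/u) e^{ux²/r}` for `0 < u ≤ r` ("since `r ≥ u`"). [cite: BrydgesSlade2015, Lemma 5.0.8 (proof)] -/
theorem one_add_sq_le (x : ℝ) {u r : ℝ} (hu : 0 < u) (hur : u ≤ r) :
    1 + x ^ 2 ≤ r / u * Real.exp (u * x ^ 2 / r) := by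
  have hr : 0 < r := hu.trans_le hur
  have h1 : 1 + u * x ^ 2 / r ≤ Real.exp (u * x ^ 2 / r) := by
    have := Real.add_one_le_exp (u * x ^ 2 / r)
    linarith
  have h2 : r / u * (1 + u * x ^ 2 / r) = r / u + x ^ 2 := by
    field_simp
  have h3 : 1 ≤ r / u := by rw [le_div_iff₀ hu]; linarith
  calc 1 + x ^ 2 ≤ r / u + x ^ 2 := by linarith
    _ = r / u * (1 + u * x ^ 2 / r) := h2.symm
    _ ≤ r / u * Real.exp (u * x ^ 2 / r) := mul_le_mul_of_nonneg_left h1 (by positivity)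

/-- **[BS-rg-IE] Lemma 5.0.8, first bound**: `(1+x)^{2r} ≤ (2r/u)^r e^{ux²}` for `u > 0` and an
integer `r ≥ u` (from `(1+x)² ≤ 2(1+x²)` and `1 + x² ≤ (r/u)e^{ux²/r}`). [cite: BrydgesSlade2015, Lemma 5.0.8 ((5.15))] -/
theorem one_add_pow_two_mul_le (x : ℝ) {u : ℝ} (hu : 0 < u) {r : ℕ} (hur : u ≤ r) :
    (1 + x) ^ (2 * r) ≤ (2 * r / u) ^ r * Real.exp (u * x ^ 2) := by
  have hr : (0 : ℝ) < r := hu.trans_le hur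
  have h1 : (1 + x) ^ 2 ≤ 2 * (1 + x ^ 2) := by nlinarith [sq_nonneg (1 - x)]
  have h2 := one_add_sq_le x hu hur
  have h0 : 0 ≤ 1 + x ^ 2 := by positivity
  calc (1 + x) ^ (2 * r) = ((1 + x) ^ 2) ^ r := by rw [pow_mul]
    _ ≤ (2 * (1 + x ^ 2)) ^ r := pow_le_pow_left₀ (sq_nonneg _) h1 r
    _ ≤ (2 * (r / u * Real.exp (u * x ^ 2 / r))) ^ r :=
        pow_le_pow_left₀ (by positivity) (mul_le_mul_of_nonneg_left h2 (by norm_num)) r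
    _ = (2 * r / u) ^ r * (Real.exp (u * x ^ 2 / r)) ^ r := by rw [← mul_pow]; ring
    _ = (2 * r / u) ^ r * Real.exp (u * x ^ 2) := by
        rw [← Real.exp_nat_mul]
        congr 2
        field_simp

/-- `1 + y^r ≤ (1+y)^r` for `y ≥ 0` and `r ≥ 1`. [folklore] -/
theorem one_add_pow_le_pow {y : ℝ} (hy : 0 ≤ y) : ∀ {r : ℕ}, 1 ≤ r → 1 + y ^ r ≤ (1 + y) ^ r
  | 0, h => absurd h (by norm_num)
  | 1, _ => by simp
  | r + 2, _ => by
      have ih := one_add_pow_le_pow hy (r := r + 1) (by omega)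
      have hp : 0 ≤ y ^ (r + 1) := pow_nonneg hy _
      calc 1 + y ^ (r + 2) = 1 + y * y ^ (r + 1) := by ring
        _ ≤ (1 + y) * (1 + y ^ (r + 1)) := by nlinarith
        _ ≤ (1 + y) * (1 + y) ^ (r + 1) := mul_le_mul_of_nonneg_left ih (by linarith)
        _ = (1 + y) ^ (r + 2) := by ring

/-- **[BS-rg-IE] Lemma 5.0.8, second bound**: `1 + u^r(1+x)^{2r} ≤ e^{2ru(1+x²)}` for `u > 0` and an
integer `r ≥ 1` ("`1 + u^r(1+x)^{2r} ≤ 1 + (2u)^r(1+x²)^r ≤ (1+2u+2ux²)^r ≤ (e^{2u+2ux²})^r`").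
[cite: BrydgesSlade2015, Lemma 5.0.8 ((5.16))] -/
theorem one_add_pow_mul_le_exp (x : ℝ) {u : ℝ} (hu : 0 < u) {r : ℕ} (hr : 1 ≤ r) :
    1 + u ^ r * (1 + x) ^ (2 * r) ≤ Real.exp (2 * r * u * (1 + x ^ 2)) := by
  have h1 : (1 + x) ^ 2 ≤ 2 * (1 + x ^ 2) := by nlinarith [sq_nonneg (1 - x)]
  have hy : 0 ≤ 2 * u * (1 + x ^ 2) := by positivity
  calc 1 + u ^ r * (1 + x) ^ (2 * r) = 1 + u ^ r * ((1 + x) ^ 2) ^ r := by rw [pow_mul]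
    _ ≤ 1 + u ^ r * (2 * (1 + x ^ 2)) ^ r := by
        gcongr
    _ = 1 + (2 * u * (1 + x ^ 2)) ^ r := by rw [← mul_pow]; ring
    _ ≤ (1 + 2 * u * (1 + x ^ 2)) ^ r := one_add_pow_le_pow hy hr
    _ ≤ (Real.exp (2 * u * (1 + x ^ 2))) ^ r := by
        refine pow_le_pow_left₀ (by positivity) ?_ r
        have := Real.add_one_le_exp (2 * u * (1 + x ^ 2))
        linarith
    _ = Real.exp (2 * r * u * (1 + x ^ 2)) := by
        rw [← Real.exp_nat_mul]
        congr 1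
        ring

end Stability

namespace LocalPoly

open Finset Tphi RGNorm Literature.Probability.LatticeModels
open scoped ContDiff

variable {d M n : ℕ} [NeZero M]

/-- `V(X)` is smooth. [folklore] -/
theorem contDiff_localPolySum (g ν u : ℝ) (X : Finset (TorusSite d M)) : ContDiff ℝ ∞ (localPolySum (n := n) g ν u X) := by
  rw [show localPolySum (n := n) g ν u X = fun φ => ∑ x ∈ X, localPoly g ν u x φ from rfl]
  exact ContDiff.sum fun x _ => contDiff_localPoly g ν u x

/-- **Brydges–Slade Proposition 3.6.1 in field-norm form**: for `F` polynomial of degree `≤ A ≤ p_𝒩`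
(coefficients of length `> A` vanish), `‖F‖_{T_φ(𝔥)} ≤ ‖F‖_{T_0(𝔥)}(1 + ‖φ‖_{Φ(𝔥)})^A`.
[cite: BrydgesSlade2015RGI, Proposition 3.6.1] -/
theorem TphiNorm_le_zero_mul_fieldNorm_pow {𝔥 R : ℝ} (h𝔥 : 0 < 𝔥) (hR : 0 < R) {pΦ pN A : ℕ} (hA : A ≤ pN)
    {F : (TorusSite d M → Fin n → ℝ) → ℝ} (hF : ContDiff ℝ ∞ F)
    (hpoly : ∀ z : List (TorusSite d M × Fin n), A < z.length → ∀ ψ, coeff (basisDir d M n) z F ψ = 0)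
    (φ : TorusSite d M → Fin n → ℝ) [Nonempty (Fin n)] :
    TphiNorm pN (latticeFamily (unitStep d M) 𝔥 R pΦ) (basisDir d M n) F φ ≤
      TphiNorm pN (latticeFamily (unitStep d M) 𝔥 R pΦ) (basisDir d M n) F 0 * (1 + fieldNorm 𝔥 R pΦ φ) ^ A := by
  have h := TphiNorm_le_TphiNorm_zero_mul (unitStep d M) h𝔥 hR hA (basisDir d M n) hF hpoly
    (fieldFn φ) (fieldNorm_nonneg h𝔥.le pΦ φ)
    (fun y β hβ => napply_le_of_fieldNorm_le h𝔥 hR le_rfl y β hβ)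
  rwa [sum_fieldFn_smul_basisDir] at h

/-- **[BS-rg-IE] Proposition 2.1.1 (Iupper)-type stability bound for Slade's `𝓘(X) = e^{-V(X)}`**:
for `V = gτ² + ντ + u` with `g ≥ 0`, `F` polynomial of degree `≤ A ≤ p_𝒩`, and any `q`,
`‖e^{-V(X)}F‖_{T_φ(𝔥)} ≤ exp(|X|[gK(q)(n/2)²𝔥⁴ + 2|ν|n𝔥² + 2|u|] + (4|ν| - qg(n/2)𝔥²)Σ_{x∈X}τ_x(φ))
· ‖F‖_{T_0}(1+‖φ‖_Φ)^A` (product property, `TphiNorm_exp_neg_localPolySum_le` and Proposition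
3.6.1; the `(1+‖φ‖_Φ)^A` is traded for `(2r/u)^r e^{u‖φ‖²}` by Lemma 5.0.8, `Stability.one_add_pow_two_mul_le`).
[cite: BrydgesSlade2015, Proposition 2.1.1 (prop:Iupper) and its proof in §5] -/
theorem TphiNorm_exp_neg_localPolySum_mul_le {𝔥 R : ℝ} (h𝔥 : 0 < 𝔥) (hR : 0 < R) {pΦ pN A : ℕ} (hA : A ≤ pN)
    {g : ℝ} (hg : 0 ≤ g) (ν u q : ℝ) (X : Finset (TorusSite d M))
    {F : (TorusSite d M → Fin n → ℝ) → ℝ} (hF : ContDiff ℝ ∞ F)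
    (hpoly : ∀ z : List (TorusSite d M × Fin n), A < z.length → ∀ ψ, coeff (basisDir d M n) z F ψ = 0)
    (φ : TorusSite d M → Fin n → ℝ) [Nonempty (Fin n)] :
    TphiNorm pN (latticeFamily (unitStep d M) 𝔥 R pΦ) (basisDir d M n) (fun ψ => Real.exp (-localPolySum g ν u X ψ) * F ψ) φ ≤
      Real.exp (X.card * (g * (quarticK q * (2⁻¹ * n) ^ 2 * 𝔥 ^ 4) + 2 * (|ν| * n * 𝔥 ^ 2 + |u|)) +
          (4 * |ν| - q * g * (2⁻¹ * n) * 𝔥 ^ 2) * ∑ x ∈ X, tau x φ) *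
        (TphiNorm pN (latticeFamily (unitStep d M) 𝔥 R pΦ) (basisDir d M n) F 0 * (1 + fieldNorm 𝔥 R pΦ φ) ^ A) := by
  have hE : ContDiff ℝ ∞ (fun ψ : TorusSite d M → Fin n → ℝ => Real.exp (-localPolySum g ν u X ψ)) :=
    Real.contDiff_exp.comp (contDiff_localPolySum g ν u X).neg
  refine (TphiNorm_mul_le_lattice (unitStep d M) h𝔥 hR pΦ pN (basisDir d M n) hE hF φ).trans ?_
  exact mul_le_mul (TphiNorm_exp_neg_localPolySum_le h𝔥 hR pΦ pN hg ν u q X φ)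
    (TphiNorm_le_zero_mul_fieldNorm_pow h𝔥 hR hA hF hpoly φ) (TphiNorm_nonneg _ _ _ _ _) (by positivity)

end LocalPoly

end LongRangePhi4

end Literature.Barriers.CriticalPhenomena
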